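import Summits.BirchSwinnertonDyer.BirchSwinnertonDyer.Theorems.KatoDescentPotSupersingularFineSelmerLeSelmer
import Literature.NumberTheory.EllipticCurves.Greenberg1999.LocalTowerKummerVanishingProofs
import Literature.NumberTheory.EllipticCurves.NeronOggShafarevichLocal
import Literature.NumberTheory.EllipticCurves.IwasawaSelmerDualProofs
import HarnessLib

/-!
# TRUE = DATUM away from `p` over a `ℤ_p`-extension: the classical Kummer local condition of
# `Sel_{p^∞}(E/K_∞)` at a place above `v ∤ p` IS "locally trivial" (Greenberg, LNM 1716, Prop. 2.1
# and (2), p. 72), and the packaging `Sel₀ = Sel ∩ (trivial above p) ∩ (trivial at ∞)`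

Cell `bsd-f1-sign2`, WIDTH-5 attach seat `bsd-line-att-p4` (gen 3) on line `birth` of crux C2
stmt-BirchSwinnertonDyer-22298 `MainConjectureOfRankZeroBSDAtTwo` (route `AlignedTransportAtTwo`); a
`--supports 22298 --as helper` file. HONEST FRAMING: kernel plumbing between the tree's two Selmer
libraries; theorems only (no `def`, no named fact, nothing booked); BSD is not proved by any of this.

WHY. Road (b″) of the crux runs Kato's §17.13 bookkeeping at `𝔭 = (2)` through the FINE Selmer group
`Sel₀ = W.fineSelmerInfty κ` (library `GreenbergSelmer`/`KatoFineSelmerDual`: classes of `H¹(K_∞, E[p^∞])`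
killed by restriction to the decomposition groups `ker κ ⊓ D_v ≤ Γ_K` at EVERY place) and the CLASSICAL
Selmer group `Sel = W.selmerInfty κ` (library `SubgroupSelmer`/`IwasawaSelmer`: classes dying in
`H¹((ker κ)_{K_v}, E(K̄_v))` at every completion), whose duals are the `Yd.X` / `D.X` of the displayed
stubs (`…FineRoadArchSquare` §1: `π_ℚ : X ↠ X₀` with kernel `(Sel/Sel₀)^∨`; the descent balance
`ℓ(ker fy) ≤ ℓ(ker fd)` and its `2`-adic defect `hdef`). The tree had `Sel₀ ≤ Sel`
(`FineSelmerLeSelmer.fineSelmerInfty_le_selmerInfty`) but NOT the converse comparison of the local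
conditions away from `p`; without it `Sel/Sel₀` is not known to be supported at the places above `p`.
This file proves, for EVERY number field `K`, elliptic `W/K`, prime `p` and EVERY `ℤ_p`-extension `κ`:

* §1 `exists_pow_smul_apply_eq_zero` — a continuous crossed homomorphism on a compact group with
  values in a discrete `p`-primary module is killed VALUE-WISE by one power of `p`.
* §2 **`LocalAway.mem_awayKer_of_mem_localKerOver`** / **`localKerOver_eq_awayKer`** — at a finite
  `v ∤ p` the classical local kernel `W.localKerOver p (ker κ) K_v` EQUALS Greenberg's
  `awayKer (ker κ) E[p^∞] v` ("locally trivial at the place of `K_∞` above `v`"): a cocycle `f` with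
  `ι f(res τ) = τ•P − P` on `H_v = Gal(K̄_v/K_{∞,η})` has `pᴺ f = 0`, so `pᴺP ∈ E(K_{∞,η})`, which is
  `p`-divisible modulo torsion (KUMMER VANISHING `E(K_{∞,η}) ⊗ ℚ_p/ℤ_p = 0`, the tree's
  `Greenberg1999.exists_sub_smul_mem_primaryComponent_fixedPoints_localSubgroup`): `pᴺP = pᴺy′ + b`,
  so `Q = P − y′` is torsion, hence algebraic (`exists_pointsMapOfEmb_eq_of_nsmul_eq_zero`), and
  `f = ∂Q` on `H_v ↠ ker κ ⊓ D_v`. Corollary `conjH1_mem_awayKer_of_mem_selmerInfty`: every class of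
  `Sel_{p^∞}(E/K_∞)` is locally trivial at every place of `K_∞` prime to `p`.
* §3 **`fineSelmerInfty_eq_selmerInfty_inf`** — `Sel₀(K_∞) = Sel(K_∞) ⊓ ⨅_{v ∣ p, σ} (trivial above v)
  ⊓ ⨅_{w ∣ ∞, σ} (trivial at w)`: the fine Selmer group is cut out of the classical one by the
  conditions ABOVE `p` and at the infinite places only (the latter vacuous unless `p = 2` and `w` real).

References: R. Greenberg, *Iwasawa theory for elliptic curves*, LNM 1716 (1999), §2 Prop. 2.1 and (2)
(p. 72: "`Sel_E(F_∞)_p` … `Im(κ_η) = 0` for `η ∤ p`"); J. Coates, R. Sujatha, Math. Ann. 331 (2005) §3;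
J.-P. Serre, *Galois Cohomology* I.§2, I.§5.1; J. H. Silverman, *AEC* Cor. III.6.4, VII.3.1, VII.6.2.
-/

set_option autoImplicit false
-- sibling precedent (`…FineRoadArchSquare.lean`): the directory name repeats the summit name
set_option linter.dupNamespace false

noncomputable section

open scoped Classical

universe u

namespace Summit.BirchSwinnertonDyer.BirchSwinnertonDyer.Theorems.AlignedTransportAtTwoFineRoad.LocalAway

open NumberField IsDedekindDomain Field
open Literature.NumberTheory.EllipticCurves Literature.NumberTheory.EllipticCurves.GreenbergSelmer
open Literature.NumberTheory.GaloisRepresentations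

/-! ## §1 One power of `p` kills a continuous cocycle with `p`-primary discrete values -/

section Compact

variable {G : Type u} [Group G] [TopologicalSpace G] [CompactSpace G]
variable {M : Type u} [AddCommGroup M] [DistribMulAction G M] [TopologicalSpace M]
  [DiscreteTopology M]

/-- A continuous crossed homomorphism on a compact group with values in a discrete module each of
whose values is killed by a power of `p` is killed VALUE-WISE by a single power of `p` (its image is
finite). Serre, *Galois Cohomology*, I.§2.2; Greenberg, LNM 1716, §1. [folklore] -/
theorem exists_pow_smul_apply_eq_zero {p : ℕ} (φ : contOneCocycles (discreteTopRep G M))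
    (h : ∀ g, ∃ k : ℕ, p ^ k • φ.1 g = 0) : ∃ N : ℕ, ∀ g, p ^ N • φ.1 g = 0 := by
  have hfin : (Set.range φ.1).Finite := (isCompact_range φ.1.continuous).finite_of_discrete
  have key : ∀ s : Finset M, (∀ m ∈ s, ∃ k : ℕ, p ^ k • m = 0) →
      ∃ N : ℕ, ∀ m ∈ s, p ^ N • m = 0 := by
    intro s
    induction s using Finset.induction_on with
    | empty => exact fun _ ↦ ⟨0, fun m hm ↦ (Finset.notMem_empty m hm).elim⟩
    | insert a s ha ih =>
      intro hs
      obtain ⟨N, hN⟩ := ih fun m hm ↦ hs m (Finset.mem_insert_of_mem hm)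
      obtain ⟨k, hk⟩ := hs a (Finset.mem_insert_self a s)
      refine ⟨N + k, fun m hm ↦ ?_⟩
      rcases Finset.mem_insert.mp hm with rfl | hm
      · rw [pow_add, mul_smul, hk, smul_zero]
      · rw [pow_add, mul_comm, mul_smul, hN m hm, smul_zero]
  obtain ⟨N, hN⟩ := key hfin.toFinset fun m hm ↦ by
    obtain ⟨g, rfl⟩ := (Set.Finite.mem_toFinset hfin).mp hm
    exact h g
  exact ⟨N, fun g ↦ hN _ ((Set.Finite.mem_toFinset hfin).mpr ⟨g, rfl⟩)⟩

end Compact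

/-! ## §2 Finite places `v ∤ p`: the classical condition over `K_∞` is "locally trivial" -/

section Away

variable {K : Type u} [Field K] [NumberField K] (W : WeierstrassCurve K) [W.IsElliptic]
  {p : ℕ} [Fact p.Prime] (κ : ZpExtension K p)

/-- **TRUE ⟹ DATUM away from `p` over `K_∞` (Greenberg, LNM 1716, §2 Prop. 2.1 + (2)).** For an
elliptic curve `E = W/K`, a prime `p`, ANY `ℤ_p`-extension `κ` and a finite place `v ∤ p`: a class of
`H¹(K_∞, E[p^∞])` satisfying the classical Kummer condition at the chosen place above `v` (it dies in
`H¹(H_v, E(K̄_v))`, `H_v = (Γ_{K_v} → Γ_K)⁻¹(ker κ) = Gal(K̄_v/K_{∞,η})`, `WeierstrassCurve.localKerOver`)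
is LOCALLY TRIVIAL there (it dies on `ker κ ⊓ D_v`, `GreenbergSelmer.awayKer`). Proof: a cocycle `f`
of the class has `ι f(res τ) = τ•P − P` on `H_v`; one power `pᴺ` kills `f`, so `pᴺ P ∈ E(K_{∞,η})`;
by Kummer vanishing (`E(K_{∞,η}) ⊗ ℚ_p/ℤ_p = 0`: `pᴺ P = pᴺ y′ + b`, `y′ ∈ E(K_{∞,η})`, `b` torsion)
the point `Q = P − y′` is torsion, hence `ι t` for a `t ∈ E[p^∞](K̄)`, and `f = ∂t` on `ker κ ⊓ D_v`
(every element of `D_v` lifts to `Γ_{K_v}`). [cite: GreenbergLNM1716, §2 Prop. 2.1 and (2) (p. 72)] -/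
theorem mem_awayKer_of_mem_localKerOver (v : HeightOneSpectrum (𝓞 K))
    (hpv : ((p : ℕ) : 𝓞 K) ∉ v.asIdeal) {c : W.subgroupH1 p κ.kerSubgroup}
    (hc : c ∈ W.localKerOver p κ.kerSubgroup (v.adicCompletion K)) :
    c ∈ awayKer κ.kerSubgroup (W.geomPrimaryTorsion p) v := by
  have hp : (p : ℕ) ≠ 0 := (Fact.out : p.Prime).ne_zero
  obtain ⟨f, rfl⟩ := oneCocycleClass_surjective _ c
  -- the Kummer triviality on `H_v`
  rw [WeierstrassCurve.mem_localKerOver_iff, WeierstrassCurve.localResOver,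
    WeierstrassCurve.localResOverOfEmb] at hc
  erw [resH1Hom_oneCocycleClass, oneCocycleClass_eq_zero_iff] at hc
  obtain ⟨P, hP⟩ := hc
  have hP' : ∀ τ : localSubgroup κ.kerSubgroup (v.adicCompletion K),
      pointsMap W (v.adicCompletion K)
          ((f.1 (resGalSubgroup κ.kerSubgroup (v.adicCompletion K) τ) : W.geomPrimaryTorsion p) :
            W.geomPoints) =
        (τ : absoluteGaloisGroup (v.adicCompletion K)) • P - P := fun τ ↦ hP τ
  -- one power of `p` kills `f`
  obtain ⟨N, hN⟩ := exists_pow_smul_apply_eq_zero (p := p) f fun g ↦ by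
    obtain ⟨k, hk⟩ := (AddCommGroup.mem_primaryComponent).1 (f.1 g).2
    exact ⟨k, Subtype.ext (by rw [AddSubgroupClass.coe_nsmul]; exact hk)⟩
  -- `y = pᴺ • P` is fixed by `H_v`
  have hy : ∀ τ : localSubgroup κ.kerSubgroup (v.adicCompletion K),
      (τ : absoluteGaloisGroup (v.adicCompletion K)) • (p ^ N • P) = p ^ N • P := by
    intro τ
    have h1 : (τ : absoluteGaloisGroup (v.adicCompletion K)) • P =
        pointsMap W (v.adicCompletion K)
          ((f.1 (resGalSubgroup κ.kerSubgroup (v.adicCompletion K) τ) : W.geomPrimaryTorsion p) :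
            W.geomPoints) + P := by
      rw [hP' τ, sub_add_cancel]
    rw [smul_comm, h1, smul_add, ← map_nsmul, ← AddSubgroupClass.coe_nsmul, hN, ZeroMemClass.coe_zero,
      map_zero, zero_add]
  set y : FixedPoints.addSubgroup (localSubgroup κ.kerSubgroup (v.adicCompletion K))
      (localPoints W (v.adicCompletion K)) :=
    ⟨p ^ N • P, (FixedPoints.mem_addSubgroup _ _ _).2 fun τ ↦ hy τ⟩ with hydef
  -- Kummer vanishing, iterated `N` times
  obtain ⟨y', hy'⟩ := PrimaryCoinvariants.exists_sub_pow_smul_mem p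
    (Greenberg1999.exists_sub_smul_mem_primaryComponent_fixedPoints_localSubgroup W κ v hpv) N y
  obtain ⟨k, hk⟩ := (AddCommGroup.mem_primaryComponent).1 hy'
  -- `Q = P - y'` is `p^(k+N)`-torsion
  have hQ : p ^ (k + N) • (P - (y' : localPoints W (v.adicCompletion K))) = 0 := by
    have h1 : ((p ^ k • (y - p ^ N • y') :
        FixedPoints.addSubgroup (localSubgroup κ.kerSubgroup (v.adicCompletion K))
          (localPoints W (v.adicCompletion K))) : localPoints W (v.adicCompletion K)) = 0 := by
      rw [hk]; rfl
    rw [AddSubgroupClass.coe_nsmul, AddSubgroupClass.coe_sub, AddSubgroupClass.coe_nsmul] at h1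
    rw [pow_add, mul_smul, smul_sub, ← h1, hydef]
  -- torsion is algebraic
  obtain ⟨t₀, ht₀, ht₀Q⟩ := exists_pointsMapOfEmb_eq_of_nsmul_eq_zero W
    (closureEmb (K := K) (v.adicCompletion K)) (pow_ne_zero _ hp) hQ
  let t : W.geomPrimaryTorsion p := ⟨t₀, (AddCommGroup.mem_primaryComponent).2 ⟨k + N, ht₀⟩⟩
  -- conclude on `ker κ ⊓ D_v`
  rw [awayKer, AddMonoidHom.mem_ker, Literature.NumberTheory.EllipticCurves.resOfLe,
    resH1Hom_oneCocycleClass, oneCocycleClass_eq_zero_iff]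
  refine ⟨t, fun g ↦ ?_⟩
  obtain ⟨σ, hσ⟩ := (mem_decomp_iff v _).1 (Subgroup.mem_inf.1 g.2).2
  have hσH : σ ∈ localSubgroup κ.kerSubgroup (v.adicCompletion K) := by
    rw [mem_localSubgroup_iff, WeierstrassCurve.resGal_eq_absGaloisRestrict, hσ]
    exact (Subgroup.mem_inf.1 g.2).1
  have hres : resGalSubgroup κ.kerSubgroup (v.adicCompletion K) ⟨σ, hσH⟩ =
      subgroupInclusion (inf_le_left : κ.kerSubgroup ⊓ decomp v ≤ κ.kerSubgroup) g :=
    Subtype.ext (by rw [resGalSubgroup_apply_coe, subgroupInclusion_apply_coe,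
      WeierstrassCurve.resGal_eq_absGaloisRestrict]; exact hσ)
  have key := hP' ⟨σ, hσH⟩
  rw [hres] at key
  -- `σ • P - P = σ • ι t₀ - ι t₀` since `y'` is fixed by `H_v`
  have hfix : σ • (y' : localPoints W (v.adicCompletion K)) = y' :=
    (FixedPoints.mem_addSubgroup _ _ _).1 y'.2 ⟨σ, hσH⟩
  have hPQ : P = pointsMapOfEmb W (closureEmb (K := K) (v.adicCompletion K)) t₀ +
      (y' : localPoints W (v.adicCompletion K)) := by
    rw [ht₀Q, sub_add_cancel]
  rw [hPQ, smul_add] at key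
  change pointsMapOfEmb W (closureEmb (K := K) (v.adicCompletion K)) _ =
    σ • pointsMapOfEmb W (closureEmb (K := K) (v.adicCompletion K)) t₀ +
      σ • (y' : localPoints W (v.adicCompletion K)) - _ at key
  have hσt : σ • pointsMapOfEmb W (closureEmb (K := K) (v.adicCompletion K)) t₀ =
      pointsMapOfEmb W (closureEmb (K := K) (v.adicCompletion K))
        ((g : absoluteGaloisGroup K) • t₀) := by
    rw [← hσ, ← WeierstrassCurve.resGal_eq_absGaloisRestrict, resGal_eq]
    exact (pointsMapOfEmb_smul W _ σ t₀).symm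
  rw [hfix, add_sub_add_right_eq_sub, hσt, ← map_sub] at key
  have key' := pointsMapOfEmb_injective W _ key
  -- back to `E[p^∞]`-coefficients
  show f.1 (subgroupInclusion (inf_le_left : κ.kerSubgroup ⊓ decomp v ≤ κ.kerSubgroup) g) =
    (g : absoluteGaloisGroup K) • t - t
  apply Subtype.ext
  rw [AddSubgroupClass.coe_sub, Literature.NumberTheory.EllipticCurves.primaryComponent.coe_smul]
  exact key'

/-- **TRUE = DATUM away from `p` over `K_∞`**: at a finite place `v ∤ p` the classical Kummer local
kernel of `H¹(K_∞, E[p^∞])` (chosen place above `v`) EQUALS Greenberg's "locally trivial" kernel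
`awayKer (ker κ) E[p^∞] v` — `mem_awayKer_of_mem_localKerOver` and the tree's converse bridge
`FineSelmerLeSelmer.localKerOver_of_mem_awayKer`. Greenberg, LNM 1716, §2 (2): "`Sel_E(F_∞)_p` is the
set of classes locally trivial at all `η ∤ p` and in `Im κ_η` at `η ∣ p`".
[cite: GreenbergLNM1716, §2 Prop. 2.1 and (2) (p. 72)] -/
theorem localKerOver_eq_awayKer (v : HeightOneSpectrum (𝓞 K)) (hpv : ((p : ℕ) : 𝓞 K) ∉ v.asIdeal) :
    W.localKerOver p κ.kerSubgroup (v.adicCompletion K) = awayKer κ.kerSubgroup (W.geomPrimaryTorsion p) v :=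
  le_antisymm (fun _ hc ↦ mem_awayKer_of_mem_localKerOver W κ v hpv hc)
    fun _ hc ↦ FineSelmerLeSelmer.localKerOver_of_mem_awayKer W p κ.kerSubgroup v hc

/-- **Every class of `Sel_{p^∞}(E/K_∞)` is locally trivial at every place of `K_∞` prime to `p`**:
for `s ∈ W.selmerInfty κ`, every finite `v ∤ p` and every `σ ∈ Γ_K` (i.e. every place of `K_∞` above
`v`), `conj_σ s ∈ awayKer (ker κ) E[p^∞] v`. [cite: GreenbergLNM1716, §2 Prop. 2.1 and (2) (p. 72)] -/
theorem conjH1_mem_awayKer_of_mem_selmerInfty {s : W.subgroupH1 p κ.kerSubgroup}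
    (hs : s ∈ W.selmerInfty κ) (v : HeightOneSpectrum (𝓞 K)) (hpv : ((p : ℕ) : 𝓞 K) ∉ v.asIdeal)
    (σ : absoluteGaloisGroup K) :
    W.conjH1 p κ.kerSubgroup σ s ∈ awayKer κ.kerSubgroup (W.geomPrimaryTorsion p) v := by
  rw [WeierstrassCurve.selmerInfty, WeierstrassCurve.mem_selmerGroupOver_iff] at hs
  exact mem_awayKer_of_mem_localKerOver W κ v hpv (hs.1 v σ)

end Away

/-! ## §3 The packaging `Sel₀(K_∞) = Sel(K_∞) ∩ (trivial above p) ∩ (trivial at ∞)` -/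

section Packaging

variable {K : Type u} [Field K] [NumberField K]

/-- For the FINE local datum `M⁺_v = 0` Greenberg's strict condition at `v` is "locally trivial at the
place above `v`" (`awayKer`): the coefficient map `M → M ⧸ 0` is a `D_v`-equivariant bijection.
[cite: Greenberg1989, §1 p. 98 (the strict condition)] -/
theorem strictKer_fineLocalDatum_eq_awayKer (H : Subgroup (absoluteGaloisGroup K)) (M : Type u)
    [AddCommGroup M] [DistribMulAction (absoluteGaloisGroup K) M] [TopologicalSpace M]
    [DiscreteTopology M] (v : HeightOneSpectrum (𝓞 K)) :
    (fineLocalDatum M v).strictKer H = awayKer H M v := by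
  ext c
  obtain ⟨φ, rfl⟩ := oneCocycleClass_surjective _ c
  rw [LocalDatum.mem_strictKer_iff, LocalDatum.strictMap, resH1Hom_oneCocycleClass,
    oneCocycleClass_eq_zero_iff, awayKer, AddMonoidHom.mem_ker,
    Literature.NumberTheory.EllipticCurves.resOfLe, resH1Hom_oneCocycleClass, oneCocycleClass_eq_zero_iff]
  constructor
  · rintro ⟨tbar, htbar⟩
    obtain ⟨t, rfl⟩ := (fineLocalDatum M v).grMk_surjective tbar
    refine ⟨t, fun g ↦ ?_⟩
    have hg := Subgroup.mem_inf.1 g.2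
    have h1 := htbar ⟨⟨(g : absoluteGaloisGroup K), hg.2⟩, (mem_decompIn_iff H v _).2 hg.1⟩
    have h2 : (fineLocalDatum M v).grMk (φ.1 ⟨g, hg.1⟩) =
        (fineLocalDatum M v).grMk ((g : absoluteGaloisGroup K) • t - t) := by
      rw [map_sub]
      exact h1
    rw [← sub_eq_zero, ← map_sub, ← AddMonoidHom.mem_ker, LocalDatum.ker_grMk] at h2
    change _ ∈ (⊥ : AddSubgroup M) at h2
    rw [AddSubgroup.mem_bot, sub_eq_zero] at h2
    exact h2
  · rintro ⟨t, ht⟩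
    refine ⟨(fineLocalDatum M v).grMk t, fun g ↦ ?_⟩
    have hgD : ((g : decomp (K := K) v) : absoluteGaloisGroup K) ∈ decomp v := (g : decomp v).2
    have hgH : ((g : decomp (K := K) v) : absoluteGaloisGroup K) ∈ H := (mem_decompIn_iff H v _).1 g.2
    have h1 := ht ⟨((g : decomp (K := K) v) : absoluteGaloisGroup K), Subgroup.mem_inf.2 ⟨hgH, hgD⟩⟩
    change (fineLocalDatum M v).grMk (φ.1 (decompInToH H v g)) =
      (g : decomp (K := K) v) • (fineLocalDatum M v).grMk t - (fineLocalDatum M v).grMk t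
    rw [LocalDatum.smul_grMk, ← map_sub]
    exact congrArg _ h1

variable (W : WeierstrassCurve K) [W.IsElliptic] {p : ℕ} [Fact p.Prime] (κ : ZpExtension K p)

/-- **`Sel₀(K_∞, E[p^∞]) = Sel_{p^∞}(E/K_∞) ∩ (locally trivial above p) ∩ (locally trivial at ∞).`**
For an elliptic curve over a number field, a prime `p` and ANY `ℤ_p`-extension `κ`, a class of
`H¹(K_∞, E[p^∞])` lies in the fine Selmer group (`W.fineSelmerInfty κ`: locally trivial at EVERY place
of `K_∞`) iff it lies in the classical Selmer group (`W.selmerInfty κ`) and is locally trivial at the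
places above `p` and at the infinite places: the conditions away from `p` AGREE (§2). Hence
`Sel/Sel₀ ↪ ∏_{w ∣ p} H¹(K_{∞,w}, E[p^∞]) × ∏_{w ∣ ∞} H¹(K_{∞,w}, E[p^∞])` — the Pontryagin dual
`ker(X ↠ X₀)` of road (b″) is supported above `p` and `∞` only (the archimedean factor being non-zero
only for `p = 2` at real places, Greenberg LNM 1716 §4 p. 106). [cite: CoatesSujatha2005, §3]
[cite: GreenbergLNM1716, §2 Prop. 2.1 and (2) (p. 72)] -/
theorem mem_fineSelmerInfty_iff (c : W.subgroupH1 p κ.kerSubgroup) :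
    c ∈ W.fineSelmerInfty κ ↔
      c ∈ W.selmerInfty κ ∧
        (∀ (v : HeightOneSpectrum (𝓞 K)), ((p : ℕ) : 𝓞 K) ∈ v.asIdeal →
          ∀ σ : absoluteGaloisGroup K,
            W.conjH1 p κ.kerSubgroup σ c ∈ awayKer κ.kerSubgroup (W.geomPrimaryTorsion p) v) ∧
        ∀ (w : InfinitePlace K) (σ : absoluteGaloisGroup K),
          W.conjH1 p κ.kerSubgroup σ c ∈ infKer κ.kerSubgroup (W.geomPrimaryTorsion p) w := by
  constructor
  · intro hc
    have hc' := (mem_strictSelmerGroupOver_iff (H := κ.kerSubgroup) (M := W.geomPrimaryTorsion p)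
      (L := fineData (W.geomPrimaryTorsion p) p) c).1 hc
    refine ⟨FineSelmerLeSelmer.fineSelmerInfty_le_selmerInfty W κ hc, fun v hv σ ↦ ?_, hc'.2.1⟩
    rw [← strictKer_fineLocalDatum_eq_awayKer]
    exact hc'.2.2 v hv σ
  · rintro ⟨hSel, hp, hinf⟩
    refine (mem_strictSelmerGroupOver_iff (H := κ.kerSubgroup) (M := W.geomPrimaryTorsion p)
      (L := fineData (W.geomPrimaryTorsion p) p) c).2 ⟨fun v hv σ ↦ ?_, hinf, fun v hv σ ↦ ?_⟩
    · exact conjH1_mem_awayKer_of_mem_selmerInfty W κ hSel v hv σ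
    · change _ ∈ (fineLocalDatum (W.geomPrimaryTorsion p) v).strictKer κ.kerSubgroup
      rw [strictKer_fineLocalDatum_eq_awayKer]
      exact hp v hv σ

/-- The same packaging as an identity of subgroups of `H¹(K_∞, E[p^∞])`:
`Sel₀ = Sel ⊓ ⨅_{v ∣ p, σ} conj_σ⁻¹(awayKer v) ⊓ ⨅_{w ∣ ∞, σ} conj_σ⁻¹(infKer w)`.
[cite: CoatesSujatha2005, §3] [cite: GreenbergLNM1716, §2 Prop. 2.1 and (2) (p. 72)] -/
theorem fineSelmerInfty_eq_selmerInfty_inf :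
    W.fineSelmerInfty κ =
      W.selmerInfty κ ⊓
        (⨅ (v : HeightOneSpectrum (𝓞 K)) (_ : ((p : ℕ) : 𝓞 K) ∈ v.asIdeal) (σ : absoluteGaloisGroup K),
          (awayKer κ.kerSubgroup (W.geomPrimaryTorsion p) v).comap (W.conjH1 p κ.kerSubgroup σ)) ⊓
        ⨅ (w : InfinitePlace K) (σ : absoluteGaloisGroup K),
          (infKer κ.kerSubgroup (W.geomPrimaryTorsion p) w).comap (W.conjH1 p κ.kerSubgroup σ) := by
  ext c
  rw [mem_fineSelmerInfty_iff]
  simp only [AddSubgroup.mem_inf, AddSubgroup.mem_iInf, AddSubgroup.mem_comap, and_assoc]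

end Packaging


end Summit.BirchSwinnertonDyer.BirchSwinnertonDyer.Theorems.AlignedTransportAtTwoFineRoad.LocalAway

end
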